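import Mathlib
import HarnessLib
import Summits.NavierStokesRegularity.NavierStokesRegularity.Theses.LocalLevelHeadDoor
import Summits.NavierStokesRegularity.NavierStokesRegularity.Theorems.LocalLevelHeadDoorHeadMonotone
import Summits.NavierStokesRegularity.NavierStokesRegularity.Theorems.LocalLevelHeadDoorClockExtinction
import Summits.NavierStokesRegularity.NavierStokesRegularity.Theorems.FrobeniusProfileRigidity.Negative.LoadBearing

/-!
# `LocalLevelHeadDoor.LevelHeadProfileRigidity` (item stmt-NavierStokesRegularity-28095, crux rank 2, THE LEVER) — PROVED

The registered skeleton `LevelHeadProfileRigidity_birth.lean` (ns-idea-6 g6, sha12 `4684503e85f1`) composed BY NAME from its two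
landed stubs: `headMonotone` (zero Bernoulli head ⇒ pointwise non-increasing speed, from the tree's head-max-point lemma 3036) and
`clockExtinction` (non-increasing speed + the Type-I clock ⇒ `v ≡ 0`), closed by
`FrobeniusProfileRigidity.Negative.not_isBackwardSingularPoint_zero_of_forall_eq_zero`.

HONEST FRAMING: a rigidity statement about HYPOTHETICAL level-head Type-I profiles; the door's Target follows only together
with items 28096/28097 (`closes`); nothing here bears on 0056 `NoTypeII` or Navier–Stokes regularity.  Seat ns-sz-p1 g5 (#237 (2)).
-/

noncomputable section

set_option linter.dupNamespace false

namespace Summit.NavierStokesRegularity.NavierStokesRegularity.Theorems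

open Summit.NavierStokesRegularity.NavierStokesRegularity.Cruxes.LevelHeadProfileRigidity.PointwiseClock (clockExtinction)
open Summit.NavierStokesRegularity.NavierStokesRegularity.Theorems.FrobeniusProfileRigidity.Negative
  (not_isBackwardSingularPoint_zero_of_forall_eq_zero)

/-- **Item stmt-NavierStokesRegularity-28095** (`LocalLevelHeadDoor.LevelHeadProfileRigidity`): a door-class profile whose
Bernoulli head vanishes on every slice is not backward-singular at the apex. [folklore] -/
theorem localLevelHeadDoor_levelHeadProfileRigidity_proof :
    Summit.NavierStokesRegularity.NavierStokesRegularity.Theses.LocalLevelHeadDoor.LevelHeadProfileRigidity := by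
  unfold Summit.NavierStokesRegularity.NavierStokesRegularity.Theses.LocalLevelHeadDoor.LevelHeadProfileRigidity
  intro C D v hrate hdec hcont hmild hdiv hhead
  exact not_isBackwardSingularPoint_zero_of_forall_eq_zero
    (clockExtinction C v hrate (LevelHeadProfileRigidity.headMonotone C D v hrate hdec hcont hmild hdiv hhead))

end Summit.NavierStokesRegularity.NavierStokesRegularity.Theorems

end
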